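import Mathlib
import HarnessLib
import Summits.Ventures.HSemireg.FibreTestW3DefectPairing
import Summits.Ventures.HSemireg.FibreTestDefectFormula

/-!
# Venture HSemireg — the Ω-reduction of the cubic supertrace law (W³): its exact (E2)-content

HONEST FRAMING. Lean leaf for the computation cell `pub-hsemireg` (target seat t-5 gen 21; file of record
`run/shared/lean/pub/pub-hsemireg/target-g6/OMEGA-LAW-t5g21.md` §0–§1). Setting and notation of
`FibreTestW3DefectPairing` (t-5 g18): odd gluing operators `u₀ u₁ u₂`, parity operator `σ` (supertrace = `trace (σ ·)`),
a first class with components `B_i` and potentials `W_i`, a second class with components `C_i` and potentials `W′_i`,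
both subject to the nine Killing relations (E1) `u_l W_j + W_j u_l = ε_{jli} B_i`, and a third class with components
`P_l` on which NOTHING is assumed (in particular NOT the closedness relation (E2) `Σ_l [u_l,P_l] = 0`). Write
`div X := Σ_l (u_l X_l - X_l u_l)` («(E2)-defect»; (E2) ⟺ `div = 0`), `S_{ab} := u_a u_b + u_b u_a` (curvature),
`T := Σ_l (B × C)_l P_l` (cubic form), `E := Σ_j B_j W′_j`, and th-3's pure-curvature expressions
`R_{lj} := [S_{l,j-1}, W_{j+1}] - [S_{l,j+1}, W_{j-1}]`.
THIS FILE kernel-checks (1) `supertrace_cubicForm_eq_defectPairing_sub_divergence`: with (E1) for the second class only,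
`str T = Σ_l str(Y_l P_l) - str(E · div P)` (t-5 g18's identity with the (E2)-term kept), and (2)
`three_supertrace_cubicForm_eq_omega`: with (E1) for the first and second classes,
`3·str T = Σ_{l,j} str(R_{lj} · W′_j · P_l) + str(div B · Σ_l W′_l P_l) - 3·str(E · div P)` — so that on CLOSED triples
(`div B = div P = 0`) the cubic supertrace equals the explicit curvature expression `Ω₁ := ⅓ Σ_{l,j} str(R_{lj} W′_j P_l)`,
which involves no closedness relation at all. The machine law (Ω)₄ «Ω₁ = 0 for all (E1)-triples at four levels»
(OMEGA-LAW-t5g21 §2; 0 violations; FALSE at five levels on th-3 g31's counter-instance to (W³)) is NOT formalised and NOT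
claimed; nothing here proves (W³); no object is constructed; nothing here bears on HC, HC_CM or HC_AV.
-/

namespace Summit.Ventures.HSemireg

open LinearMap

/-- **Three defect pairings = curvature expression + divergence term** (t-5 g21, OMEGA-LAW-t5g21 §1.3–1.4; any
ring). With the nine Killing relations (E1) of the FIRST class `(B, W)` and ARBITRARY `V_j`, `P_l`:
`3·Σ_l Y_l P_l = Σ_{l,j} R_{lj} V_j P_l + div B · Σ_l V_l P_l`, where `Y_l = Σ_j [u_l,B_j] V_j` (defect pairings),
`R_{lj} = [S_{l,j-1},W_{j+1}] - [S_{l,j+1},W_{j-1}]` (th-3's pure-curvature expressions, `S_{ab} = u_a u_b + u_b u_a`) and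
`div B = Σ_k [u_k,B_k]` — th-3's defect formula `3[u_l,B_j] = δ_{lj} div B + R_{lj}` substituted into the defect
pairings (rows 1, 2 of the formula = the row-0 theorems of `FibreTestDefectFormula` relabelled `0 → 1 → 2 → 0`). [folklore] -/
theorem three_defectPairing_eq_curvature_add_divergence {R : Type*} [Ring R]
    (u₀ u₁ u₂ B₀ B₁ B₂ W₀ W₁ W₂ V₀ V₁ V₂ P₀ P₁ P₂ : R)
    (h00 : u₀ * W₀ + W₀ * u₀ = 0) (h01 : u₀ * W₁ + W₁ * u₀ = -B₂) (h02 : u₀ * W₂ + W₂ * u₀ = B₁)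
    (h11 : u₁ * W₁ + W₁ * u₁ = 0) (h12 : u₁ * W₂ + W₂ * u₁ = -B₀) (h10 : u₁ * W₀ + W₀ * u₁ = B₂)
    (h22 : u₂ * W₂ + W₂ * u₂ = 0) (h20 : u₂ * W₀ + W₀ * u₂ = -B₁) (h21 : u₂ * W₁ + W₁ * u₂ = B₀) :
    3 * (((u₀ * B₀ - B₀ * u₀) * V₀ + (u₀ * B₁ - B₁ * u₀) * V₁ + (u₀ * B₂ - B₂ * u₀) * V₂) * P₀ + ((u₁ * B₀ - B₀ * u₁) * V₀ + (u₁ * B₁ - B₁ * u₁) * V₁ + (u₁ * B₂ - B₂ * u₁) * V₂) * P₁ + ((u₂ * B₀ - B₀ * u₂) * V₀ + (u₂ * B₁ - B₁ * u₂) * V₁ + (u₂ * B₂ - B₂ * u₂) * V₂) * P₂)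
      = ((((u₀ * u₂ + u₂ * u₀) * W₁ - W₁ * (u₀ * u₂ + u₂ * u₀)) - ((u₀ * u₁ + u₁ * u₀) * W₂ - W₂ * (u₀ * u₁ + u₁ * u₀))) * V₀ * P₀ + (((u₀ * u₀ + u₀ * u₀) * W₂ - W₂ * (u₀ * u₀ + u₀ * u₀)) - ((u₀ * u₂ + u₂ * u₀) * W₀ - W₀ * (u₀ * u₂ + u₂ * u₀))) * V₁ * P₀ + (((u₀ * u₁ + u₁ * u₀) * W₀ - W₀ * (u₀ * u₁ + u₁ * u₀)) - ((u₀ * u₀ + u₀ * u₀) * W₁ - W₁ * (u₀ * u₀ + u₀ * u₀))) * V₂ * P₀ + (((u₁ * u₂ + u₂ * u₁) * W₁ - W₁ * (u₁ * u₂ + u₂ * u₁)) - ((u₁ * u₁ + u₁ * u₁) * W₂ - W₂ * (u₁ * u₁ + u₁ * u₁))) * V₀ * P₁ + (((u₁ * u₀ + u₀ * u₁) * W₂ - W₂ * (u₁ * u₀ + u₀ * u₁)) - ((u₁ * u₂ + u₂ * u₁) * W₀ - W₀ * (u₁ * u₂ + u₂ * u₁))) * V₁ * P₁ + (((u₁ *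 u₁ + u₁ * u₁) * W₀ - W₀ * (u₁ * u₁ + u₁ * u₁)) - ((u₁ * u₀ + u₀ * u₁) * W₁ - W₁ * (u₁ * u₀ + u₀ * u₁))) * V₂ * P₁ + (((u₂ * u₂ + u₂ * u₂) * W₁ - W₁ * (u₂ * u₂ + u₂ * u₂)) - ((u₂ * u₁ + u₁ * u₂) * W₂ - W₂ * (u₂ * u₁ + u₁ * u₂))) * V₀ * P₂ + (((u₂ * u₀ + u₀ * u₂) * W₂ - W₂ * (u₂ * u₀ + u₀ * u₂)) - ((u₂ * u₂ + u₂ * u₂) * W₀ - W₀ * (u₂ * u₂ + u₂ * u₂))) * V₁ * P₂ + (((u₂ * u₁ + u₁ * u₂) * W₀ - W₀ * (u₂ * u₁ + u₁ * u₂)) - ((u₂ * u₀ + u₀ * u₂) * W₁ - W₁ * (u₂ * u₀ + u₀ * u₂))) * V₂ * P₂)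
        + ((u₀ * B₀ - B₀ * u₀) + (u₁ * B₁ - B₁ * u₁) + (u₂ * B₂ - B₂ * u₂)) * (V₀ * P₀ + V₁ * P₁ + V₂ * P₂) := by
  have d00 := defectFormula_row0_col0 u₀ u₁ u₂ B₀ B₁ B₂ W₁ W₂ h01 h02 h12 h21
  have d01 := defectFormula_row0_col1 u₀ u₂ B₁ W₀ W₂ h00 h02 h20
  have d02 := defectFormula_row0_col2 u₀ u₁ B₂ W₀ W₁ h00 h01 h10
  have d11 := defectFormula_row0_col0 u₁ u₂ u₀ B₁ B₂ B₀ W₂ W₀ h12 h10 h20 h02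
  have d12 := defectFormula_row0_col1 u₁ u₀ B₂ W₁ W₀ h11 h10 h01
  have d10 := defectFormula_row0_col2 u₁ u₂ B₀ W₁ W₂ h11 h12 h21
  have d22 := defectFormula_row0_col0 u₂ u₀ u₁ B₂ B₀ B₁ W₀ W₁ h20 h21 h01 h10
  have d20 := defectFormula_row0_col1 u₂ u₁ B₀ W₂ W₁ h22 h21 h12
  have d21 := defectFormula_row0_col2 u₂ u₀ B₁ W₂ W₀ h22 h20 h02
  have key : 3 * (((u₀ * B₀ - B₀ * u₀) * V₀ + (u₀ * B₁ - B₁ * u₀) * V₁ + (u₀ * B₂ - B₂ * u₀) * V₂) * P₀ + ((u₁ * B₀ - B₀ * u₁) * V₀ + (u₁ * B₁ - B₁ * u₁) * V₁ + (u₁ * B₂ - B₂ * u₁) * V₂) * P₁ + ((u₂ * B₀ - B₀ * u₂) * V₀ + (u₂ * B₁ - B₁ * u₂) * V₁ + (u₂ * B₂ - B₂ * u₂) * V₂) * P₂)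
      - (((((u₀ * u₂ + u₂ * u₀) * W₁ - W₁ * (u₀ * u₂ + u₂ * u₀)) - ((u₀ * u₁ + u₁ * u₀) * W₂ - W₂ * (u₀ * u₁ + u₁ * u₀))) * V₀ * P₀ + (((u₀ * u₀ + u₀ * u₀) * W₂ - W₂ * (u₀ * u₀ + u₀ * u₀)) - ((u₀ * u₂ + u₂ * u₀) * W₀ - W₀ * (u₀ * u₂ + u₂ * u₀))) * V₁ * P₀ + (((u₀ * u₁ + u₁ * u₀) * W₀ - W₀ * (u₀ * u₁ + u₁ * u₀)) - ((u₀ * u₀ + u₀ * u₀) * W₁ - W₁ * (u₀ * u₀ + u₀ * u₀))) * V₂ * P₀ + (((u₁ * u₂ + u₂ * u₁) * W₁ - W₁ * (u₁ * u₂ + u₂ * u₁)) - ((u₁ * u₁ + u₁ * u₁) * W₂ - W₂ * (u₁ * u₁ + u₁ * u₁))) * V₀ * P₁ + (((u₁ * u₀ + u₀ * u₁) * W₂ - W₂ * (u₁ * u₀ + u₀ * u₁)) - ((u₁ * u₂ + u₂ * u₁) * W₀ - W₀ * (u₁ * u₂ + u₂ * u₁))) * V₁ * P₁ + (((u₁ *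 u₁ + u₁ * u₁) * W₀ - W₀ * (u₁ * u₁ + u₁ * u₁)) - ((u₁ * u₀ + u₀ * u₁) * W₁ - W₁ * (u₁ * u₀ + u₀ * u₁))) * V₂ * P₁ + (((u₂ * u₂ + u₂ * u₂) * W₁ - W₁ * (u₂ * u₂ + u₂ * u₂)) - ((u₂ * u₁ + u₁ * u₂) * W₂ - W₂ * (u₂ * u₁ + u₁ * u₂))) * V₀ * P₂ + (((u₂ * u₀ + u₀ * u₂) * W₂ - W₂ * (u₂ * u₀ + u₀ * u₂)) - ((u₂ * u₂ + u₂ * u₂) * W₀ - W₀ * (u₂ * u₂ + u₂ * u₂))) * V₁ * P₂ + (((u₂ * u₁ + u₁ * u₂) * W₀ - W₀ * (u₂ * u₁ + u₁ * u₂)) - ((u₂ * u₀ + u₀ * u₂) * W₁ - W₁ * (u₂ * u₀ + u₀ * u₂))) * V₂ * P₂)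
        + ((u₀ * B₀ - B₀ * u₀) + (u₁ * B₁ - B₁ * u₁) + (u₂ * B₂ - B₂ * u₂)) * (V₀ * P₀ + V₁ * P₁ + V₂ * P₂))
      = (3 * (u₀ * B₀ - B₀ * u₀) - ((u₀ * B₀ - B₀ * u₀) + (u₁ * B₁ - B₁ * u₁) + (u₂ * B₂ - B₂ * u₂)) - (((u₀ * u₂ + u₂ * u₀) * W₁ - W₁ * (u₀ * u₂ + u₂ * u₀)) - ((u₀ * u₁ + u₁ * u₀) * W₂ - W₂ * (u₀ * u₁ + u₁ * u₀)))) * V₀ * P₀ + (3 * (u₀ * B₁ - B₁ * u₀) - (((u₀ * u₀ + u₀ * u₀) * W₂ - W₂ * (u₀ * u₀ + u₀ * u₀)) - ((u₀ * u₂ + u₂ * u₀) * W₀ - W₀ * (u₀ * u₂ + u₂ * u₀)))) * V₁ * P₀ + (3 * (u₀ * B₂ - B₂ * u₀) - (((u₀ * u₁ + u₁ * u₀) * W₀ - W₀ * (u₀ * u₁ + u₁ * u₀)) - ((u₀ * u₀ + u₀ * u₀) * W₁ - W₁ * (u₀ * u₀ + u₀ * u₀)))) * V₂ * P₀ + (3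 * (u₁ * B₀ - B₀ * u₁) - (((u₁ * u₂ + u₂ * u₁) * W₁ - W₁ * (u₁ * u₂ + u₂ * u₁)) - ((u₁ * u₁ + u₁ * u₁) * W₂ - W₂ * (u₁ * u₁ + u₁ * u₁)))) * V₀ * P₁ + (3 * (u₁ * B₁ - B₁ * u₁) - ((u₁ * B₁ - B₁ * u₁) + (u₂ * B₂ - B₂ * u₂) + (u₀ * B₀ - B₀ * u₀)) - (((u₁ * u₀ + u₀ * u₁) * W₂ - W₂ * (u₁ * u₀ + u₀ * u₁)) - ((u₁ * u₂ + u₂ * u₁) * W₀ - W₀ * (u₁ * u₂ + u₂ * u₁)))) * V₁ * P₁ + (3 * (u₁ * B₂ - B₂ * u₁) - (((u₁ * u₁ + u₁ * u₁) * W₀ - W₀ * (u₁ * u₁ + u₁ * u₁)) - ((u₁ * u₀ + u₀ * u₁) * W₁ - W₁ * (u₁ * u₀ + u₀ * u₁)))) * V₂ * P₁ + (3 * (u₂ * B₀ - B₀ * u₂) - (((u₂ * u₂ + u₂ * u₂) * W₁ - W₁ * (u₂ * u₂ + u₂ * u₂)) - ((u₂ * u₁ + u₁ * u₂) * W₂ -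 W₂ * (u₂ * u₁ + u₁ * u₂)))) * V₀ * P₂ + (3 * (u₂ * B₁ - B₁ * u₂) - (((u₂ * u₀ + u₀ * u₂) * W₂ - W₂ * (u₂ * u₀ + u₀ * u₂)) - ((u₂ * u₂ + u₂ * u₂) * W₀ - W₀ * (u₂ * u₂ + u₂ * u₂)))) * V₁ * P₂ + (3 * (u₂ * B₂ - B₂ * u₂) - ((u₂ * B₂ - B₂ * u₂) + (u₀ * B₀ - B₀ * u₀) + (u₁ * B₁ - B₁ * u₁)) - (((u₂ * u₁ + u₁ * u₂) * W₀ - W₀ * (u₂ * u₁ + u₁ * u₂)) - ((u₂ * u₀ + u₀ * u₂) * W₁ - W₁ * (u₂ * u₀ + u₀ * u₂)))) * V₂ * P₂ := by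
    noncomm_ring
  rw [d00, d01, d02, d11, d12, d10, d22, d20, d21] at key
  have : 3 * (((u₀ * B₀ - B₀ * u₀) * V₀ + (u₀ * B₁ - B₁ * u₀) * V₁ + (u₀ * B₂ - B₂ * u₀) * V₂) * P₀ + ((u₁ * B₀ - B₀ * u₁) * V₀ + (u₁ * B₁ - B₁ * u₁) * V₁ + (u₁ * B₂ - B₂ * u₁) * V₂) * P₁ + ((u₂ * B₀ - B₀ * u₂) * V₀ + (u₂ * B₁ - B₁ * u₂) * V₁ + (u₂ * B₂ - B₂ * u₂) * V₂) * P₂)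
      - (((((u₀ * u₂ + u₂ * u₀) * W₁ - W₁ * (u₀ * u₂ + u₂ * u₀)) - ((u₀ * u₁ + u₁ * u₀) * W₂ - W₂ * (u₀ * u₁ + u₁ * u₀))) * V₀ * P₀ + (((u₀ * u₀ + u₀ * u₀) * W₂ - W₂ * (u₀ * u₀ + u₀ * u₀)) - ((u₀ * u₂ + u₂ * u₀) * W₀ - W₀ * (u₀ * u₂ + u₂ * u₀))) * V₁ * P₀ + (((u₀ * u₁ + u₁ * u₀) * W₀ - W₀ * (u₀ * u₁ + u₁ * u₀)) - ((u₀ * u₀ + u₀ * u₀) * W₁ - W₁ * (u₀ * u₀ + u₀ * u₀))) * V₂ * P₀ + (((u₁ * u₂ + u₂ * u₁) * W₁ - W₁ * (u₁ * u₂ + u₂ * u₁)) - ((u₁ * u₁ + u₁ * u₁) * W₂ - W₂ * (u₁ * u₁ + u₁ * u₁))) * V₀ * P₁ + (((u₁ * u₀ + u₀ * u₁) * W₂ - W₂ * (u₁ * u₀ + u₀ * u₁)) - ((u₁ * u₂ + u₂ * u₁) * W₀ - W₀ * (u₁ * u₂ + u₂ * u₁))) * V₁ * P₁ + (((u₁ *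 u₁ + u₁ * u₁) * W₀ - W₀ * (u₁ * u₁ + u₁ * u₁)) - ((u₁ * u₀ + u₀ * u₁) * W₁ - W₁ * (u₁ * u₀ + u₀ * u₁))) * V₂ * P₁ + (((u₂ * u₂ + u₂ * u₂) * W₁ - W₁ * (u₂ * u₂ + u₂ * u₂)) - ((u₂ * u₁ + u₁ * u₂) * W₂ - W₂ * (u₂ * u₁ + u₁ * u₂))) * V₀ * P₂ + (((u₂ * u₀ + u₀ * u₂) * W₂ - W₂ * (u₂ * u₀ + u₀ * u₂)) - ((u₂ * u₂ + u₂ * u₂) * W₀ - W₀ * (u₂ * u₂ + u₂ * u₂))) * V₁ * P₂ + (((u₂ * u₁ + u₁ * u₂) * W₀ - W₀ * (u₂ * u₁ + u₁ * u₂)) - ((u₂ * u₀ + u₀ * u₂) * W₁ - W₁ * (u₂ * u₀ + u₀ * u₂))) * V₂ * P₂)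
        + ((u₀ * B₀ - B₀ * u₀) + (u₁ * B₁ - B₁ * u₁) + (u₂ * B₂ - B₂ * u₂)) * (V₀ * P₀ + V₁ * P₁ + V₂ * P₂)) = 0 := by
    rw [key]; noncomm_ring
  exact sub_eq_zero.mp this

variable {F : Type*} [Field F]
variable {U : Type*} [AddCommGroup U] [Module F U]

/-- **Step 1 with the (E2)-term kept** (t-5 g18/g21; OMEGA-LAW-t5g21 §1.2). For a parity operator `σ` anticommuting
with `u₀ u₁ u₂`, arbitrary `B_i` and `P_l`, and a second class `(C, V)` satisfying the nine Killing relations (E1):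
`str T = Σ_l str(Y_l P_l) - str(E · div P)` with `Y_l = Σ_i [u_l,B_i] V_i`, `E = Σ_i B_i V_i`, `div P = Σ_l [u_l,P_l]`.
(With `div P = 0`, i.e. (E2) for the third class, this is t-5 g18's `supertrace_cubicForm_eq_supertrace_defectPairing`.)
[folklore] -/
theorem supertrace_cubicForm_eq_defectPairing_sub_divergence
    (σ u₀ u₁ u₂ B₀ B₁ B₂ V₀ V₁ V₂ C₀ C₁ C₂ P₀ P₁ P₂ : Module.End F U)
    (hσ0 : σ * u₀ = -(u₀ * σ)) (hσ1 : σ * u₁ = -(u₁ * σ)) (hσ2 : σ * u₂ = -(u₂ * σ))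
    (k00 : u₀ * V₀ + V₀ * u₀ = 0) (k01 : u₀ * V₁ + V₁ * u₀ = -C₂) (k02 : u₀ * V₂ + V₂ * u₀ = C₁)
    (k11 : u₁ * V₁ + V₁ * u₁ = 0) (k12 : u₁ * V₂ + V₂ * u₁ = -C₀) (k10 : u₁ * V₀ + V₀ * u₁ = C₂)
    (k22 : u₂ * V₂ + V₂ * u₂ = 0) (k20 : u₂ * V₀ + V₀ * u₂ = -C₁) (k21 : u₂ * V₁ + V₁ * u₂ = C₀) :
    LinearMap.trace F U (σ * ((B₁ * C₂ - B₂ * C₁) * P₀ + (B₂ * C₀ - B₀ * C₂) * P₁ + (B₀ * C₁ - B₁ * C₀) * P₂))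
      = LinearMap.trace F U (σ * (((u₀ * B₀ - B₀ * u₀) * V₀ + (u₀ * B₁ - B₁ * u₀) * V₁ + (u₀ * B₂ - B₂ * u₀) * V₂) * P₀ + ((u₁ * B₀ - B₀ * u₁) * V₀ + (u₁ * B₁ - B₁ * u₁) * V₁ + (u₁ * B₂ - B₂ * u₁) * V₂) * P₁ + ((u₂ * B₀ - B₀ * u₂) * V₀ + (u₂ * B₁ - B₁ * u₂) * V₁ + (u₂ * B₂ - B₂ * u₂) * V₂) * P₂))
        - LinearMap.trace F U (σ * ((B₀ * V₀ + B₁ * V₁ + B₂ * V₂) * ((u₀ * P₀ - P₀ * u₀) + (u₁ * P₁ - P₁ * u₁) + (u₂ * P₂ - P₂ * u₂)))) := by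
  have c0 := crossComponent_eq_defectPairing_sub_anticomm u₀ B₀ B₁ B₂ V₀ V₁ V₂ C₁ C₂ k00 k01 k02
  have c1 := crossComponent_eq_defectPairing_sub_anticomm u₁ B₁ B₂ B₀ V₁ V₂ V₀ C₂ C₀ k11 k12 k10
  have c2 := crossComponent_eq_defectPairing_sub_anticomm u₂ B₂ B₀ B₁ V₂ V₀ V₁ C₀ C₁ k22 k20 k21
  have a0 := supertrace_anticomm_mul_eq_supertrace_mul_comm σ u₀ (B₀ * V₀ + B₁ * V₁ + B₂ * V₂) P₀ hσ0
  have a1 := supertrace_anticomm_mul_eq_supertrace_mul_comm σ u₁ (B₀ * V₀ + B₁ * V₁ + B₂ * V₂) P₁ hσ1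
  have a2 := supertrace_anticomm_mul_eq_supertrace_mul_comm σ u₂ (B₀ * V₀ + B₁ * V₁ + B₂ * V₂) P₂ hσ2
  have e1 : B₁ * V₁ + B₂ * V₂ + B₀ * V₀ = (B₀ * V₀ + B₁ * V₁ + B₂ * V₂) := by abel
  have e2 : B₂ * V₂ + B₀ * V₀ + B₁ * V₁ = (B₀ * V₀ + B₁ * V₁ + B₂ * V₂) := by abel
  rw [e1] at c1
  rw [e2] at c2
  have eT : σ * ((B₁ * C₂ - B₂ * C₁) * P₀ + (B₂ * C₀ - B₀ * C₂) * P₁ + (B₀ * C₁ - B₁ * C₀) * P₂)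
      = σ * ((B₁ * C₂ - B₂ * C₁) * P₀) + σ * ((B₂ * C₀ - B₀ * C₂) * P₁) + σ * ((B₀ * C₁ - B₁ * C₀) * P₂) := by
    noncomm_ring
  rw [eT, map_add, map_add, c0, c1, c2]
  have s0 : σ * ((((u₀ * B₀ - B₀ * u₀) * V₀ + (u₀ * B₁ - B₁ * u₀) * V₁ + (u₀ * B₂ - B₂ * u₀) * V₂) - (u₀ * (B₀ * V₀ + B₁ * V₁ + B₂ * V₂) + (B₀ * V₀ + B₁ * V₁ + B₂ * V₂) * u₀)) * P₀)
      = σ * (((u₀ * B₀ - B₀ * u₀) * V₀ + (u₀ * B₁ - B₁ * u₀) * V₁ + (u₀ * B₂ - B₂ * u₀) * V₂) * P₀) - σ * ((u₀ * (B₀ * V₀ + B₁ * V₁ + B₂ * V₂) + (B₀ * V₀ + B₁ * V₁ + B₂ * V₂) * u₀) * P₀) := by noncomm_ring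
  have s1 : σ * ((((u₁ * B₁ - B₁ * u₁) * V₁ + (u₁ * B₂ - B₂ * u₁) * V₂ + (u₁ * B₀ - B₀ * u₁) * V₀) - (u₁ * (B₀ * V₀ + B₁ * V₁ + B₂ * V₂) + (B₀ * V₀ + B₁ * V₁ + B₂ * V₂) * u₁)) * P₁)
      = σ * (((u₁ * B₀ - B₀ * u₁) * V₀ + (u₁ * B₁ - B₁ * u₁) * V₁ + (u₁ * B₂ - B₂ * u₁) * V₂) * P₁) - σ * ((u₁ * (B₀ * V₀ + B₁ * V₁ + B₂ * V₂) + (B₀ * V₀ + B₁ * V₁ + B₂ * V₂) * u₁) * P₁) := by noncomm_ring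
  have s2 : σ * ((((u₂ * B₂ - B₂ * u₂) * V₂ + (u₂ * B₀ - B₀ * u₂) * V₀ + (u₂ * B₁ - B₁ * u₂) * V₁) - (u₂ * (B₀ * V₀ + B₁ * V₁ + B₂ * V₂) + (B₀ * V₀ + B₁ * V₁ + B₂ * V₂) * u₂)) * P₂)
      = σ * (((u₂ * B₀ - B₀ * u₂) * V₀ + (u₂ * B₁ - B₁ * u₂) * V₁ + (u₂ * B₂ - B₂ * u₂) * V₂) * P₂) - σ * ((u₂ * (B₀ * V₀ + B₁ * V₁ + B₂ * V₂) + (B₀ * V₀ + B₁ * V₁ + B₂ * V₂) * u₂) * P₂) := by noncomm_ring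
  rw [s0, s1, s2, map_sub, map_sub, map_sub, a0, a1, a2]
  have lhs : LinearMap.trace F U (σ * (((u₀ * B₀ - B₀ * u₀) * V₀ + (u₀ * B₁ - B₁ * u₀) * V₁ + (u₀ * B₂ - B₂ * u₀) * V₂) * P₀ + ((u₁ * B₀ - B₀ * u₁) * V₀ + (u₁ * B₁ - B₁ * u₁) * V₁ + (u₁ * B₂ - B₂ * u₁) * V₂) * P₁ + ((u₂ * B₀ - B₀ * u₂) * V₀ + (u₂ * B₁ - B₁ * u₂) * V₁ + (u₂ * B₂ - B₂ * u₂) * V₂) * P₂))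
      = LinearMap.trace F U (σ * (((u₀ * B₀ - B₀ * u₀) * V₀ + (u₀ * B₁ - B₁ * u₀) * V₁ + (u₀ * B₂ - B₂ * u₀) * V₂) * P₀)) + LinearMap.trace F U (σ * (((u₁ * B₀ - B₀ * u₁) * V₀ + (u₁ * B₁ - B₁ * u₁) * V₁ + (u₁ * B₂ - B₂ * u₁) * V₂) * P₁))
        + LinearMap.trace F U (σ * (((u₂ * B₀ - B₀ * u₂) * V₀ + (u₂ * B₁ - B₁ * u₂) * V₁ + (u₂ * B₂ - B₂ * u₂) * V₂) * P₂)) := by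
    rw [← map_add, ← map_add]; congr 1; noncomm_ring
  have rhs : LinearMap.trace F U (σ * ((B₀ * V₀ + B₁ * V₁ + B₂ * V₂) * ((u₀ * P₀ - P₀ * u₀) + (u₁ * P₁ - P₁ * u₁) + (u₂ * P₂ - P₂ * u₂))))
      = LinearMap.trace F U (σ * ((B₀ * V₀ + B₁ * V₁ + B₂ * V₂) * (u₀ * P₀ - P₀ * u₀))) + LinearMap.trace F U (σ * ((B₀ * V₀ + B₁ * V₁ + B₂ * V₂) * (u₁ * P₁ - P₁ * u₁)))
        + LinearMap.trace F U (σ * ((B₀ * V₀ + B₁ * V₁ + B₂ * V₂) * (u₂ * P₂ - P₂ * u₂))) := by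
    rw [← map_add, ← map_add]; congr 1; noncomm_ring
  rw [lhs, rhs]
  abel

/-- **The Ω-reduction of (W³)** (t-5 g21, OMEGA-LAW-t5g21 §0 (A)). With a parity operator `σ` anticommuting with
`u₀ u₁ u₂`, (E1) for the first class `(B, W)` and for the second class `(C, V)` (nine Killing relations each), and NO
hypothesis on the third class `P`:
`str(T + T + T) = Σ_{l,j} str(R_{lj} · V_j · P_l) + str(div B · Σ_l V_l P_l) - str(E·div P + E·div P + E·div P)`.
Hence on CLOSED triples (`div B = 0 = div P`) the cubic supertrace is one third of the explicit curvature expression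
`Σ str(R_{lj} V_j P_l)`, which contains no closedness relation: the whole (E2)-content of (W³) is the two `div` terms.
The observed four-level law «that curvature expression vanishes for ALL (E1)-triples» is NOT formalised here. [folklore] -/
theorem supertrace_cubicForm_three_eq_omega
    (σ u₀ u₁ u₂ B₀ B₁ B₂ W₀ W₁ W₂ V₀ V₁ V₂ C₀ C₁ C₂ P₀ P₁ P₂ : Module.End F U)
    (hσ0 : σ * u₀ = -(u₀ * σ)) (hσ1 : σ * u₁ = -(u₁ * σ)) (hσ2 : σ * u₂ = -(u₂ * σ))
    (h00 : u₀ * W₀ + W₀ * u₀ = 0) (h01 : u₀ * W₁ + W₁ * u₀ = -B₂) (h02 : u₀ * W₂ + W₂ * u₀ = B₁)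
    (h11 : u₁ * W₁ + W₁ * u₁ = 0) (h12 : u₁ * W₂ + W₂ * u₁ = -B₀) (h10 : u₁ * W₀ + W₀ * u₁ = B₂)
    (h22 : u₂ * W₂ + W₂ * u₂ = 0) (h20 : u₂ * W₀ + W₀ * u₂ = -B₁) (h21 : u₂ * W₁ + W₁ * u₂ = B₀)
    (k00 : u₀ * V₀ + V₀ * u₀ = 0) (k01 : u₀ * V₁ + V₁ * u₀ = -C₂) (k02 : u₀ * V₂ + V₂ * u₀ = C₁)
    (k11 : u₁ * V₁ + V₁ * u₁ = 0) (k12 : u₁ * V₂ + V₂ * u₁ = -C₀) (k10 : u₁ * V₀ + V₀ * u₁ = C₂)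
    (k22 : u₂ * V₂ + V₂ * u₂ = 0) (k20 : u₂ * V₀ + V₀ * u₂ = -C₁) (k21 : u₂ * V₁ + V₁ * u₂ = C₀) :
    LinearMap.trace F U (σ * (((B₁ * C₂ - B₂ * C₁) * P₀ + (B₂ * C₀ - B₀ * C₂) * P₁ + (B₀ * C₁ - B₁ * C₀) * P₂) + ((B₁ * C₂ - B₂ * C₁) * P₀ + (B₂ * C₀ - B₀ * C₂) * P₁ + (B₀ * C₁ - B₁ * C₀) * P₂) + ((B₁ * C₂ - B₂ * C₁) * P₀ + (B₂ * C₀ - B₀ * C₂) * P₁ + (B₀ * C₁ - B₁ * C₀) * P₂)))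
      = LinearMap.trace F U (σ * ((((u₀ * u₂ + u₂ * u₀) * W₁ - W₁ * (u₀ * u₂ + u₂ * u₀)) - ((u₀ * u₁ + u₁ * u₀) * W₂ - W₂ * (u₀ * u₁ + u₁ * u₀))) * V₀ * P₀ + (((u₀ * u₀ + u₀ * u₀) * W₂ - W₂ * (u₀ * u₀ + u₀ * u₀)) - ((u₀ * u₂ + u₂ * u₀) * W₀ - W₀ * (u₀ * u₂ + u₂ * u₀))) * V₁ * P₀ + (((u₀ * u₁ + u₁ * u₀) * W₀ - W₀ * (u₀ * u₁ + u₁ * u₀)) - ((u₀ * u₀ + u₀ * u₀) * W₁ - W₁ * (u₀ * u₀ + u₀ * u₀))) * V₂ * P₀ + (((u₁ * u₂ + u₂ * u₁) * W₁ - W₁ * (u₁ * u₂ + u₂ * u₁)) - ((u₁ * u₁ + u₁ * u₁) * W₂ - W₂ * (u₁ * u₁ + u₁ * u₁))) * V₀ * P₁ + (((u₁ * u₀ + u₀ * u₁) * W₂ - W₂ * (u₁ * u₀ + u₀ * u₁)) - ((u₁ * u₂ + u₂ * u₁) * W₀ - W₀ * (u₁ * u₂ + u₂ * u₁))) * V₁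 * P₁ + (((u₁ * u₁ + u₁ * u₁) * W₀ - W₀ * (u₁ * u₁ + u₁ * u₁)) - ((u₁ * u₀ + u₀ * u₁) * W₁ - W₁ * (u₁ * u₀ + u₀ * u₁))) * V₂ * P₁ + (((u₂ * u₂ + u₂ * u₂) * W₁ - W₁ * (u₂ * u₂ + u₂ * u₂)) - ((u₂ * u₁ + u₁ * u₂) * W₂ - W₂ * (u₂ * u₁ + u₁ * u₂))) * V₀ * P₂ + (((u₂ * u₀ + u₀ * u₂) * W₂ - W₂ * (u₂ * u₀ + u₀ * u₂)) - ((u₂ * u₂ + u₂ * u₂) * W₀ - W₀ * (u₂ * u₂ + u₂ * u₂))) * V₁ * P₂ + (((u₂ * u₁ + u₁ * u₂) * W₀ - W₀ * (u₂ * u₁ + u₁ * u₂)) - ((u₂ * u₀ + u₀ * u₂) * W₁ - W₁ * (u₂ * u₀ + u₀ * u₂))) * V₂ * P₂))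
        + LinearMap.trace F U (σ * (((u₀ * B₀ - B₀ * u₀) + (u₁ * B₁ - B₁ * u₁) + (u₂ * B₂ - B₂ * u₂)) * (V₀ * P₀ + V₁ * P₁ + V₂ * P₂)))
        - LinearMap.trace F U (σ * ((B₀ * V₀ + B₁ * V₁ + B₂ * V₂) * ((u₀ * P₀ - P₀ * u₀) + (u₁ * P₁ - P₁ * u₁) + (u₂ * P₂ - P₂ * u₂)) + (B₀ * V₀ + B₁ * V₁ + B₂ * V₂) * ((u₀ * P₀ - P₀ * u₀) + (u₁ * P₁ - P₁ * u₁) + (u₂ * P₂ - P₂ * u₂)) + (B₀ * V₀ + B₁ * V₁ + B₂ * V₂) * ((u₀ * P₀ - P₀ * u₀) + (u₁ * P₁ - P₁ * u₁) + (u₂ * P₂ - P₂ * u₂)))) := by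
  have t1 := supertrace_cubicForm_eq_defectPairing_sub_divergence σ u₀ u₁ u₂ B₀ B₁ B₂ V₀ V₁ V₂ C₀ C₁ C₂ P₀ P₁ P₂
    hσ0 hσ1 hσ2 k00 k01 k02 k11 k12 k10 k22 k20 k21
  have r := three_defectPairing_eq_curvature_add_divergence u₀ u₁ u₂ B₀ B₁ B₂ W₀ W₁ W₂ V₀ V₁ V₂ P₀ P₁ P₂
    h00 h01 h02 h11 h12 h10 h22 h20 h21
  have e3 : σ * (((B₁ * C₂ - B₂ * C₁) * P₀ + (B₂ * C₀ - B₀ * C₂) * P₁ + (B₀ * C₁ - B₁ * C₀) * P₂) + ((B₁ * C₂ - B₂ * C₁) * P₀ + (B₂ * C₀ - B₀ * C₂) * P₁ + (B₀ * C₁ - B₁ * C₀) * P₂) + ((B₁ * C₂ - B₂ * C₁) * P₀ + (B₂ * C₀ - B₀ * C₂) * P₁ + (B₀ * C₁ - B₁ * C₀) * P₂)) = σ * ((B₁ * C₂ - B₂ * C₁) * P₀ + (B₂ * C₀ - B₀ * C₂) * P₁ + (B₀ * C₁ - B₁ * C₀) * P₂) + σ * ((B₁ * C₂ - B₂ * C₁)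 * P₀ + (B₂ * C₀ - B₀ * C₂) * P₁ + (B₀ * C₁ - B₁ * C₀) * P₂) + σ * ((B₁ * C₂ - B₂ * C₁) * P₀ + (B₂ * C₀ - B₀ * C₂) * P₁ + (B₀ * C₁ - B₁ * C₀) * P₂) := by noncomm_ring
  have e4 : σ * ((B₀ * V₀ + B₁ * V₁ + B₂ * V₂) * ((u₀ * P₀ - P₀ * u₀) + (u₁ * P₁ - P₁ * u₁) + (u₂ * P₂ - P₂ * u₂)) + (B₀ * V₀ + B₁ * V₁ + B₂ * V₂) * ((u₀ * P₀ - P₀ * u₀) + (u₁ * P₁ - P₁ * u₁) + (u₂ * P₂ - P₂ * u₂)) + (B₀ * V₀ + B₁ * V₁ + B₂ * V₂) * ((u₀ * P₀ - P₀ * u₀) + (u₁ * P₁ - P₁ * u₁) + (u₂ * P₂ - P₂ * u₂)))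
      = σ * ((B₀ * V₀ + B₁ * V₁ + B₂ * V₂) * ((u₀ * P₀ - P₀ * u₀) + (u₁ * P₁ - P₁ * u₁) + (u₂ * P₂ - P₂ * u₂))) + σ * ((B₀ * V₀ + B₁ * V₁ + B₂ * V₂) * ((u₀ * P₀ - P₀ * u₀) + (u₁ * P₁ - P₁ * u₁) + (u₂ * P₂ - P₂ * u₂))) + σ * ((B₀ * V₀ + B₁ * V₁ + B₂ * V₂) * ((u₀ * P₀ - P₀ * u₀) + (u₁ * P₁ - P₁ * u₁) + (u₂ * P₂ - P₂ * u₂))) := by noncomm_ring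
  have e5 : LinearMap.trace F U (σ * ((((u₀ * u₂ + u₂ * u₀) * W₁ - W₁ * (u₀ * u₂ + u₂ * u₀)) - ((u₀ * u₁ + u₁ * u₀) * W₂ - W₂ * (u₀ * u₁ + u₁ * u₀))) * V₀ * P₀ + (((u₀ * u₀ + u₀ * u₀) * W₂ - W₂ * (u₀ * u₀ + u₀ * u₀)) - ((u₀ * u₂ + u₂ * u₀) * W₀ - W₀ * (u₀ * u₂ + u₂ * u₀))) * V₁ * P₀ + (((u₀ * u₁ + u₁ * u₀) * W₀ - W₀ * (u₀ * u₁ + u₁ * u₀)) - ((u₀ * u₀ + u₀ * u₀) * W₁ - W₁ * (u₀ * u₀ + u₀ * u₀))) * V₂ * P₀ + (((u₁ * u₂ + u₂ * u₁) * W₁ - W₁ * (u₁ * u₂ + u₂ * u₁)) - ((u₁ * u₁ + u₁ * u₁) * W₂ - W₂ * (u₁ * u₁ + u₁ * u₁))) * V₀ * P₁ + (((u₁ * u₀ + u₀ * u₁) * W₂ - W₂ * (u₁ * u₀ + u₀ * u₁)) - ((u₁ * u₂ + u₂ * u₁) * W₀ - W₀ * (u₁ * u₂ + u₂ * u₁)))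 * V₁ * P₁ + (((u₁ * u₁ + u₁ * u₁) * W₀ - W₀ * (u₁ * u₁ + u₁ * u₁)) - ((u₁ * u₀ + u₀ * u₁) * W₁ - W₁ * (u₁ * u₀ + u₀ * u₁))) * V₂ * P₁ + (((u₂ * u₂ + u₂ * u₂) * W₁ - W₁ * (u₂ * u₂ + u₂ * u₂)) - ((u₂ * u₁ + u₁ * u₂) * W₂ - W₂ * (u₂ * u₁ + u₁ * u₂))) * V₀ * P₂ + (((u₂ * u₀ + u₀ * u₂) * W₂ - W₂ * (u₂ * u₀ + u₀ * u₂)) - ((u₂ * u₂ + u₂ * u₂) * W₀ - W₀ * (u₂ * u₂ + u₂ * u₂))) * V₁ * P₂ + (((u₂ * u₁ + u₁ * u₂) * W₀ - W₀ * (u₂ * u₁ + u₁ * u₂)) - ((u₂ * u₀ + u₀ * u₂) * W₁ - W₁ * (u₂ * u₀ + u₀ * u₂))) * V₂ * P₂)) + LinearMap.trace F U (σ * (((u₀ * B₀ - B₀ * u₀) + (u₁ * B₁ - B₁ * u₁) + (u₂ * B₂ - B₂ * u₂)) * (V₀ * P₀ + V₁ * P₁ + V₂ * P₂)))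
      = LinearMap.trace F U (σ * (((u₀ * B₀ - B₀ * u₀) * V₀ + (u₀ * B₁ - B₁ * u₀) * V₁ + (u₀ * B₂ - B₂ * u₀) * V₂) * P₀ + ((u₁ * B₀ - B₀ * u₁) * V₀ + (u₁ * B₁ - B₁ * u₁) * V₁ + (u₁ * B₂ - B₂ * u₁) * V₂) * P₁ + ((u₂ * B₀ - B₀ * u₂) * V₀ + (u₂ * B₁ - B₁ * u₂) * V₁ + (u₂ * B₂ - B₂ * u₂) * V₂) * P₂)) + LinearMap.trace F U (σ * (((u₀ * B₀ - B₀ * u₀) * V₀ + (u₀ * B₁ - B₁ * u₀) * V₁ + (u₀ * B₂ - B₂ * u₀) * V₂) * P₀ + ((u₁ * B₀ - B₀ * u₁) * V₀ + (u₁ * B₁ - B₁ * u₁) * V₁ + (u₁ * B₂ - B₂ * u₁) * V₂) * P₁ + ((u₂ * B₀ - B₀ * u₂) * V₀ + (u₂ * B₁ - B₁ * u₂) * V₁ + (u₂ * B₂ - B₂ * u₂) * V₂) * P₂)) + LinearMap.trace F U (σ * (((u₀ * B₀ - B₀ * u₀) * V₀ + (u₀ * B₁ - B₁ * u₀) * V₁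 + (u₀ * B₂ - B₂ * u₀) * V₂) * P₀ + ((u₁ * B₀ - B₀ * u₁) * V₀ + (u₁ * B₁ - B₁ * u₁) * V₁ + (u₁ * B₂ - B₂ * u₁) * V₂) * P₁ + ((u₂ * B₀ - B₀ * u₂) * V₀ + (u₂ * B₁ - B₁ * u₂) * V₁ + (u₂ * B₂ - B₂ * u₂) * V₂) * P₂)) := by
    rw [← map_add, ← map_add, ← map_add]; congr 1
    have : σ * ((((u₀ * u₂ + u₂ * u₀) * W₁ - W₁ * (u₀ * u₂ + u₂ * u₀)) - ((u₀ * u₁ + u₁ * u₀) * W₂ - W₂ * (u₀ * u₁ + u₁ * u₀))) * V₀ * P₀ + (((u₀ * u₀ + u₀ * u₀) * W₂ - W₂ * (u₀ * u₀ + u₀ * u₀)) - ((u₀ * u₂ + u₂ * u₀) * W₀ - W₀ * (u₀ * u₂ + u₂ * u₀))) * V₁ * P₀ + (((u₀ * u₁ + u₁ * u₀) * W₀ - W₀ * (u₀ * u₁ + u₁ * u₀)) - ((u₀ * u₀ + u₀ * u₀) * W₁ - W₁ * (u₀ * u₀ + u₀ * u₀))) * V₂ * P₀ + (((u₁ * u₂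 + u₂ * u₁) * W₁ - W₁ * (u₁ * u₂ + u₂ * u₁)) - ((u₁ * u₁ + u₁ * u₁) * W₂ - W₂ * (u₁ * u₁ + u₁ * u₁))) * V₀ * P₁ + (((u₁ * u₀ + u₀ * u₁) * W₂ - W₂ * (u₁ * u₀ + u₀ * u₁)) - ((u₁ * u₂ + u₂ * u₁) * W₀ - W₀ * (u₁ * u₂ + u₂ * u₁))) * V₁ * P₁ + (((u₁ * u₁ + u₁ * u₁) * W₀ - W₀ * (u₁ * u₁ + u₁ * u₁)) - ((u₁ * u₀ + u₀ * u₁) * W₁ - W₁ * (u₁ * u₀ + u₀ * u₁))) * V₂ * P₁ + (((u₂ * u₂ + u₂ * u₂) * W₁ - W₁ * (u₂ * u₂ + u₂ * u₂)) - ((u₂ * u₁ + u₁ * u₂) * W₂ - W₂ * (u₂ * u₁ + u₁ * u₂))) * V₀ * P₂ + (((u₂ * u₀ + u₀ * u₂) * W₂ - W₂ * (u₂ * u₀ + u₀ * u₂)) - ((u₂ * u₂ + u₂ * u₂) * W₀ - W₀ * (u₂ * u₂ + u₂ * u₂))) * V₁ * P₂ + (((u₂ * u₁ + u₁ * u₂)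 * W₀ - W₀ * (u₂ * u₁ + u₁ * u₂)) - ((u₂ * u₀ + u₀ * u₂) * W₁ - W₁ * (u₂ * u₀ + u₀ * u₂))) * V₂ * P₂) + σ * (((u₀ * B₀ - B₀ * u₀) + (u₁ * B₁ - B₁ * u₁) + (u₂ * B₂ - B₂ * u₂)) * (V₀ * P₀ + V₁ * P₁ + V₂ * P₂)) = σ * (3 * (((u₀ * B₀ - B₀ * u₀) * V₀ + (u₀ * B₁ - B₁ * u₀) * V₁ + (u₀ * B₂ - B₂ * u₀) * V₂) * P₀ + ((u₁ * B₀ - B₀ * u₁) * V₀ + (u₁ * B₁ - B₁ * u₁) * V₁ + (u₁ * B₂ - B₂ * u₁) * V₂) * P₁ + ((u₂ * B₀ - B₀ * u₂) * V₀ + (u₂ * B₁ - B₁ * u₂) * V₁ + (u₂ * B₂ - B₂ * u₂) * V₂) * P₂)) := by rw [r]; noncomm_ring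
    rw [this]; noncomm_ring
  rw [e3, e4, map_add, map_add, map_add, map_add, t1, e5]
  abel

end Summit.Ventures.HSemireg
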